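import Summits.CriticalPhenomena.Ising3DConformalLimit.Theorems.ArmHyperscalingOneArmHyperscalingMirrorFaceDefs
import Summits.CriticalPhenomena.Ising3DConformalLimit.Theorems.HyperoctahedralRPCriticalCorrNineMirrorRP
import Literature.Probability.LatticeModels.PlusStateFKG
import HarnessLib

/-!
# The mirror Cauchy–Schwarz inequality `T² ≤ ⟨σ₀σ_{2ne₀}⟩_{β_c} · S`
(route ArmHyperscaling, crux `OneArmHyperscaling`, item stmt-CriticalPhenomena-15591, line
`mirror-face-saturation`, registered stub `stub_mirrorCauchySchwarz : MirrorCauchySchwarz`)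

Statement (`stub_mirrorCauchySchwarz`, literally the line's `def MirrorCauchySchwarz : Prop` of the
definitions module `Theorems/ArmHyperscalingOneArmHyperscalingMirrorFaceDefs.lean`): for `K ≥ 2`, `n ≥ 1`,
`faceResponse K n ^ 2 ≤ criticalTwoPoint 3 (2n e₀) * mirrorGram K n`, i.e.
`T² ≤ ⟨σ₀σ_{2ne₀}⟩_{β_c} · S` with `T = Σ_{y' ∈ θA} ⟨σ_x σ_{y'}⟩_{β_c}`,
`S = Σ_{y ∈ A, y' ∈ θA} ⟨σ_y σ_{y'}⟩_{β_c}`, `x = n e₀ = evalSite n`, `A = mirrorPatch K n` (the plane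
`y₀ = Kn + 1 - n > 0`), `θA = facePatch K n`, `θ : y ↦ (-y₀, y₁, y₂)` the site mirror `{y₀ = 0}`.

Proof. Reflection positivity of the critical state in the coordinate mirror `{y₀ = 0}`
(Fröhlich–Israel–Lieb–Simon 1978, Thm. 3.1; tree theorem `criticalCorrNineMirrorRP_proof`, item
stmt-CriticalPhenomena-1985) applied to the family of one-site blocks `{x} ∪ A ⊂ {y₀ > 0}` with
coefficients `(t, 1, …, 1)` gives the nonnegative quadratic polynomial
`0 ≤ t² ⟨σ_{θx}σ_x⟩ + t Σ_{y∈A} ⟨σ_{θx}σ_y⟩ + t Σ_{y∈A} ⟨σ_{θy}σ_x⟩ + Σ_{y,y'∈A} ⟨σ_{θy}σ_{y'}⟩`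
(`rp_point_patch`). The four coefficients are identified with `⟨σ₀σ_{2ne₀}⟩`, `T`, `T`, `S` by the
translation invariance of the plus state on pair correlations (`plusPair_eq_twoPointPlus_sub`,
Friedli–Velenik 2017 Thm. 3.17: `⟨σ_aσ_b⟩ = G(b - a)`, hence `G(-v) = G(v)`), `θx = -x`, and the two
bijections `θ, y ↦ -y : A → θA`; the discriminant inequality (`discrim_le_zero`) is the claim.

References: J. Fröhlich, R. Israel, E. H. Lieb, B. Simon, Comm. Math. Phys. 62 (1978) 1–34, Thm. 3.1;
S. Friedli, Y. Velenik, *Statistical Mechanics of Lattice Systems* (CUP 2017), Thm. 3.17, Lemma 10.8.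
No definitions are introduced.
-/

noncomputable section

namespace Summit.CriticalPhenomena.Ising3DConformalLimit.Cruxes.OneArmHyperscaling.MirrorFaceSaturation

open Literature.Probability.LatticeModels
open Summit.CriticalPhenomena.Ising3DConformalLimit.HyperoctahedralRPNineMirror
  (criticalCorrNineMirrorRP_proof)

/-! ### The critical pair correlator -/

/-- `criticalCorr 3 2 ![a, b] = ⟨σ_a σ_b⟩⁺_{β_c} = ⟨σ₀ σ_{b-a}⟩⁺_{β_c}` (translation invariance of the
plus state, Friedli–Velenik 2017 Thm. 3.17, tree `plusPair_eq_twoPointPlus_sub`).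
[cite: FriedliVelenik2017, Thm. 3.17] -/
private theorem corr_two_eq (a b : Site 3) :
    criticalCorr 3 2 ![a, b] = criticalTwoPoint 3 (b - a) := by
  -- adapted from `criticalCorr_two_pair` (Literature/Probability/LatticeModels/HighDimPointwiseTriviality)
  have h1 : criticalCorr 3 2 ![a, b] = plusPair 3 (criticalBeta 3) a b := by
    change plusExpect 3 (criticalBeta 3) 0 (spinMonomial ![a, b]) =
      plusExpect 3 (criticalBeta 3) 0 (spinPair a b)
    congr 1
    funext s
    simp [spinMonomial, spinPair, Fin.prod_univ_two]
  rw [h1, plusPair_eq_twoPointPlus_sub (criticalBeta_nonneg 3)]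
  rfl

/-- Symmetry of the pair correlator `⟨σ_a σ_b⟩ = ⟨σ_b σ_a⟩` (commutativity of the spin product).
[folklore] -/
private theorem corr_two_comm (a b : Site 3) :
    criticalCorr 3 2 ![a, b] = criticalCorr 3 2 ![b, a] := by
  change plusExpect 3 (criticalBeta 3) 0 (spinMonomial ![a, b]) =
    plusExpect 3 (criticalBeta 3) 0 (spinMonomial ![b, a])
  congr 1
  funext s
  simp [spinMonomial, Fin.prod_univ_two, mul_comm]

/-- Evenness of the critical two-point function, `⟨σ₀σ_{-v}⟩_{β_c} = ⟨σ₀σ_v⟩_{β_c}` (translation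
invariance and symmetry of the pair correlator). [folklore] -/
private theorem criticalTwoPoint_neg_eq (v : Site 3) :
    criticalTwoPoint 3 (-v) = criticalTwoPoint 3 v := by
  have h := corr_two_eq v 0
  rw [corr_two_comm, corr_two_eq, sub_zero, zero_sub] at h
  exact h.symm

/-- A pair correlator written as the correlator of two concatenated one-site blocks
(`Fin.append` of arity `1 + 1`), the shape produced by the reflection-positivity theorem.
[folklore] -/
private theorem corr_append_one_one (u v : Site 3) :
    criticalCorr 3 (1 + 1) (Fin.append (fun _ : Fin 1 => u) (fun _ : Fin 1 => v)) =
      criticalCorr 3 2 ![u, v] := by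
  have h : spinMonomial (Fin.append (fun _ : Fin 1 => u) (fun _ : Fin 1 => v)) =
      spinMonomial (![u, v] : Fin 2 → Site 3) := by
    funext s
    simp only [spinMonomial]
    rw [Fin.prod_univ_add]
    simp only [Fin.append_left, Fin.append_right, Fin.prod_univ_one, Fin.prod_univ_two,
      Matrix.cons_val_zero, Matrix.cons_val_one]
  show plusExpect 3 (criticalBeta 3) 0 _ = plusExpect 3 (criticalBeta 3) 0 _
  rw [h]

/-! ### Reflection positivity in the site mirror `{y₀ = 0}` -/

/-- **Reflection positivity of the critical state in the coordinate mirror `{y₀ = 0}`, one-site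
blocks indexed by a finite type**: for sites `z_a` with `(z_a)₀ > 0` and real `c_a`,
`0 ≤ Σ_{a,b} c_a c_b ⟨σ_{θ z_a} σ_{z_b}⟩_{β_c}`, `θ y = (-y₀, y₁, y₂)` (Fröhlich–Israel–Lieb–Simon
1978 Thm. 3.1; the tree theorem `criticalCorrNineMirrorRP_proof`, reindexed along `ι ≃ Fin |ι|`).
[cite: FrohlichEtAl1978, §3 Thm 3.1] -/
private theorem rp_fintype {ι : Type*} [Fintype ι] (z : ι → Site 3) (c : ι → ℝ)
    (hz : ∀ a, 0 < z a 0) :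
    0 ≤ ∑ a, ∑ b, c a * c b *
      criticalCorr 3 2 ![Function.update (z a) 0 (-(z a 0)), z b] := by
  have h := criticalCorrNineMirrorRP_proof (fun y => Function.update y 0 (-y 0)) (fun y => y 0)
    ⟨0, 1, by decide, Or.inl ⟨rfl, rfl⟩⟩ (Fintype.card ι) (fun _ => 1)
    (fun a _ => z ((Fintype.equivFin ι).symm a)) (fun a => c ((Fintype.equivFin ι).symm a))
    (fun a _ => hz _)
  simp only [corr_append_one_one] at h
  exact h.trans_eq (Fintype.sum_equiv (Fintype.equivFin ι).symm _ _ fun a =>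
    Fintype.sum_equiv (Fintype.equivFin ι).symm _ _ fun b => rfl)

/-- **The OS quadratic form of a point and a patch.** For a site `x` and a finite set `A` in the
open half-space `{y₀ > 0}` and real `t`, reflection positivity for the blocks `{x} ∪ A` with
coefficients `(t, 1, …, 1)`:
`0 ≤ t² ⟨σ_{θx}σ_x⟩ + t Σ_{y∈A} ⟨σ_{θx}σ_y⟩ + t Σ_{y∈A} ⟨σ_{θy}σ_x⟩ + Σ_{y,y'∈A} ⟨σ_{θy}σ_{y'}⟩`.
[cite: FrohlichEtAl1978, §3 Thm 3.1] -/
private theorem rp_point_patch (x : Site 3) (A : Finset (Site 3)) (hx : 0 < x 0)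
    (hA : ∀ y ∈ A, 0 < y 0) (t : ℝ) :
    0 ≤ t * t * criticalCorr 3 2 ![Function.update x 0 (-(x 0)), x] +
      t * ∑ y ∈ A, criticalCorr 3 2 ![Function.update x 0 (-(x 0)), y] +
      t * ∑ y ∈ A, criticalCorr 3 2 ![Function.update y 0 (-(y 0)), x] +
      ∑ y ∈ A, ∑ y' ∈ A, criticalCorr 3 2 ![Function.update y 0 (-(y 0)), y'] := by
  have h := rp_fintype (ι := Option A) (fun o => o.elim x Subtype.val)
    (fun o => o.elim t fun _ => 1) (fun o => by
      cases o with
      | none => exact hx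
      | some y => exact hA y y.2)
  simp only [Fintype.sum_option, Option.elim_none, Option.elim_some, one_mul, mul_one,
    Finset.sum_add_distrib, ← Finset.mul_sum] at h
  simp only [← Finset.sum_coe_sort A]
  linarith

/-! ### The two patches: coordinates and the bijections `θ`, `y ↦ -y` -/

/-- Coordinates of the members of `facePatch K n`: `y₀ = n - Kn - 1`, `|y₁|, |y₂| ≤ Kn`. [folklore] -/
private theorem mem_facePatch_iff {K n : ℕ} {y : Site 3} :
    y ∈ facePatch K n ↔ y 0 = (n : ℤ) - ((K * n : ℕ) : ℤ) - 1 ∧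
      (-((K * n : ℕ) : ℤ) ≤ y 1 ∧ y 1 ≤ ((K * n : ℕ) : ℤ)) ∧
      (-((K * n : ℕ) : ℤ) ≤ y 2 ∧ y 2 ≤ ((K * n : ℕ) : ℤ)) := by
  simp [facePatch, Fintype.mem_piFinset, Fin.forall_fin_succ]

/-- Coordinates of the members of `mirrorPatch K n`: `y₀ = Kn + 1 - n`, `|y₁|, |y₂| ≤ Kn`. [folklore] -/
private theorem mem_mirrorPatch_iff {K n : ℕ} {y : Site 3} :
    y ∈ mirrorPatch K n ↔ y 0 = ((K * n : ℕ) : ℤ) + 1 - (n : ℤ) ∧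
      (-((K * n : ℕ) : ℤ) ≤ y 1 ∧ y 1 ≤ ((K * n : ℕ) : ℤ)) ∧
      (-((K * n : ℕ) : ℤ) ≤ y 2 ∧ y 2 ≤ ((K * n : ℕ) : ℤ)) := by
  simp [mirrorPatch, Fintype.mem_piFinset, Fin.forall_fin_succ]

/-- The mirror `θ` is an involution. [folklore] -/
private theorem mirror_mirror (y : Site 3) :
    Function.update (Function.update y 0 (-(y 0))) 0 (-(Function.update y 0 (-(y 0)) 0)) = y := by
  simp

/-- `θ` maps the mirror patch into the face patch. [folklore] -/
private theorem mirror_mem_facePatch {K n : ℕ} {y : Site 3} (hy : y ∈ mirrorPatch K n) :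
    Function.update y 0 (-(y 0)) ∈ facePatch K n := by
  rw [mem_mirrorPatch_iff] at hy
  have h1 : Function.update y 0 (-(y 0)) 1 = y 1 := Function.update_of_ne (by decide) _ _
  have h2 : Function.update y 0 (-(y 0)) 2 = y 2 := Function.update_of_ne (by decide) _ _
  rw [mem_facePatch_iff, Function.update_self, h1, h2]
  omega

/-- `θ` maps the face patch into the mirror patch. [folklore] -/
private theorem face_mem_mirrorPatch {K n : ℕ} {y : Site 3} (hy : y ∈ facePatch K n) :
    Function.update y 0 (-(y 0)) ∈ mirrorPatch K n := by
  rw [mem_facePatch_iff] at hy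
  have h1 : Function.update y 0 (-(y 0)) 1 = y 1 := Function.update_of_ne (by decide) _ _
  have h2 : Function.update y 0 (-(y 0)) 2 = y 2 := Function.update_of_ne (by decide) _ _
  rw [mem_mirrorPatch_iff, Function.update_self, h1, h2]
  omega

/-- `y ↦ -y` maps the mirror patch into the face patch (the ranges of `y₁, y₂` are symmetric).
[folklore] -/
private theorem neg_mirror_mem_facePatch {K n : ℕ} {y : Site 3} (hy : y ∈ mirrorPatch K n) :
    -y ∈ facePatch K n := by
  rw [mem_mirrorPatch_iff] at hy
  rw [mem_facePatch_iff, Pi.neg_apply, Pi.neg_apply, Pi.neg_apply]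
  omega

/-- `y ↦ -y` maps the face patch into the mirror patch. [folklore] -/
private theorem neg_face_mem_mirrorPatch {K n : ℕ} {y : Site 3} (hy : y ∈ facePatch K n) :
    -y ∈ mirrorPatch K n := by
  rw [mem_facePatch_iff] at hy
  rw [mem_mirrorPatch_iff, Pi.neg_apply, Pi.neg_apply, Pi.neg_apply]
  omega

/-- `θ x = -x` for the evaluation site `x = n e₀`. [folklore] -/
private theorem mirror_evalSite (n : ℕ) :
    Function.update (evalSite n) 0 (-(evalSite n 0)) = -evalSite n := by
  funext i
  by_cases hi : i = 0
  · subst hi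
    simp
  · rw [Function.update_of_ne hi, Pi.neg_apply, evalSite, Pi.single_eq_of_ne hi, neg_zero]

/-! ### Identification of the four coefficients -/

/-- `⟨σ_{θx} σ_x⟩_{β_c} = ⟨σ₀ σ_{2ne₀}⟩_{β_c}` for `x = n e₀` (translation invariance). [folklore] -/
private theorem corr_mirror_evalSite (n : ℕ) :
    criticalCorr 3 2 ![Function.update (evalSite n) 0 (-(evalSite n 0)), evalSite n] =
      criticalTwoPoint 3 (Pi.single 0 (2 * (n : ℤ))) := by
  rw [mirror_evalSite, corr_two_eq, sub_neg_eq_add]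
  congr 1
  funext i
  by_cases hi : i = 0
  · subst hi
    simp [evalSite, two_mul]
  · simp [evalSite, Pi.single_eq_of_ne hi]

/-- `Σ_{y ∈ A} ⟨σ_{θx} σ_y⟩_{β_c} = T`: `θx = -x`, `⟨σ_{-x}σ_y⟩ = G(y + x) = G(-y - x) = ⟨σ_xσ_{-y}⟩`
and `y ↦ -y : A → θA` is a bijection. [folklore] -/
private theorem sum_corr_mirror_evalSite (K n : ℕ) :
    ∑ y ∈ mirrorPatch K n,
        criticalCorr 3 2 ![Function.update (evalSite n) 0 (-(evalSite n 0)), y] =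
      faceResponse K n := by
  unfold faceResponse
  rw [mirror_evalSite]
  refine Finset.sum_nbij' Neg.neg Neg.neg (fun y hy => neg_mirror_mem_facePatch hy)
    (fun y hy => neg_face_mem_mirrorPatch hy) (fun y _ => neg_neg y) (fun y _ => neg_neg y)
    (fun y _ => ?_)
  rw [corr_two_eq, corr_two_eq, sub_neg_eq_add, ← criticalTwoPoint_neg_eq (y + evalSite n),
    neg_add']

/-- `Σ_{y ∈ A} ⟨σ_{θy} σ_x⟩_{β_c} = T`: `θ : A → θA` is a bijection and the pair correlator is
symmetric. [folklore] -/
private theorem sum_corr_mirror_left (K n : ℕ) :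
    ∑ y ∈ mirrorPatch K n, criticalCorr 3 2 ![Function.update y 0 (-(y 0)), evalSite n] =
      faceResponse K n := by
  unfold faceResponse
  exact Finset.sum_nbij' (fun y => Function.update y 0 (-(y 0)))
    (fun y => Function.update y 0 (-(y 0))) (fun y hy => mirror_mem_facePatch hy)
    (fun y hy => face_mem_mirrorPatch hy) (fun y _ => mirror_mirror y) (fun y _ => mirror_mirror y)
    (fun y _ => corr_two_comm _ _)

/-- `Σ_{y, y' ∈ A} ⟨σ_{θy} σ_{y'}⟩_{β_c} = S`: swap the two sums, reindex the inner one along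
`θ : A → θA` and use the symmetry of the pair correlator. [folklore] -/
private theorem sum_sum_corr_mirror (K n : ℕ) :
    ∑ y ∈ mirrorPatch K n, ∑ y' ∈ mirrorPatch K n,
        criticalCorr 3 2 ![Function.update y 0 (-(y 0)), y'] = mirrorGram K n := by
  rw [Finset.sum_comm]
  unfold mirrorGram
  refine Finset.sum_congr rfl fun y' _ => ?_
  exact Finset.sum_nbij' (fun y => Function.update y 0 (-(y 0)))
    (fun y => Function.update y 0 (-(y 0))) (fun y hy => mirror_mem_facePatch hy)
    (fun y hy => face_mem_mirrorPatch hy) (fun y _ => mirror_mirror y) (fun y _ => mirror_mirror y)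
    (fun y _ => corr_two_comm _ _)

/-! ### The stub -/

/-- **`MirrorCauchySchwarz`** (registered stub `stub_mirrorCauchySchwarz` of the line
`mirror-face-saturation`, crux `OneArmHyperscaling`, item stmt-CriticalPhenomena-15591): for `K ≥ 2`
and `n ≥ 1`, `T_{K,n}² ≤ ⟨σ₀σ_{2ne₀}⟩_{β_c} · S_{K,n}`, the Osterwalder–Schrader Cauchy–Schwarz
inequality for the pair `(σ_{x_n}, M_A)`, `A = mirrorPatch K n`, in the site mirror `{y₀ = 0}`:
reflection positivity of the critical state (Fröhlich–Israel–Lieb–Simon 1978 Thm. 3.1, tree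
`criticalCorrNineMirrorRP_proof`) makes `t ↦ t²⟨σ₀σ_{2ne₀}⟩ + 2tT + S` nonnegative
(`rp_point_patch` and the identifications above), and the discriminant inequality concludes.
[cite: FrohlichEtAl1978, §3 Thm 3.1] -/
theorem stub_mirrorCauchySchwarz : MirrorFaceSaturation.MirrorCauchySchwarz := by
  intro K n hK hn
  have hKn : n ≤ K * n := Nat.le_mul_of_pos_left n (by omega)
  have hx : 0 < evalSite n 0 := by
    simp only [evalSite, Pi.single_eq_same]
    omega
  have hA : ∀ y ∈ mirrorPatch K n, 0 < y 0 := fun y hy => by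
    rw [mem_mirrorPatch_iff] at hy
    omega
  have quad : ∀ t : ℝ, 0 ≤ criticalTwoPoint 3 (Pi.single 0 (2 * (n : ℤ))) * (t * t) +
      2 * faceResponse K n * t + mirrorGram K n := fun t => by
    have h := rp_point_patch (evalSite n) (mirrorPatch K n) hx hA t
    rw [corr_mirror_evalSite, sum_corr_mirror_evalSite, sum_corr_mirror_left,
      sum_sum_corr_mirror] at h
    linarith
  have hd := discrim_le_zero quad
  rw [discrim] at hd
  nlinarith [hd]

end Summit.CriticalPhenomena.Ising3DConformalLimit.Cruxes.OneArmHyperscaling.MirrorFaceSaturation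

end
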